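/-
Copyright (c) 2026 the pub-hodgecm-mathlib formalisation cell (harness21).  Prover seat hodgecm-mathlib-LH4-p11 (g8), req620 Track A «(D-RAM) FOUR-FRAME» squad, helper lane on
h413 = stmt-HodgeConjecture-24833 (count-neutral).  Dealer∕pen LH4-plan (g13) WORD #96 (2) «LH4-p11 OWNS THE PURE CELLS»; SIG-PureCells v1 (9a3f5135) §2 FILE 1b (per stratum).  2026-09-04.
-/
import Summits.HodgeConjecture.HodgeConjecture.Theorems.F0P3cDyRamLabelledOddPureLatticeT          -- FILE 1a (this seat): `labelledOddCount_div_relIndex_latt_axis2 ∕ _latt_axis1`; brings ★ p860467 HEAD C, ★ B4 axis lattices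
import Summits.HodgeConjecture.HodgeConjecture.Theorems.F0P3cDyRamLabelledKappaSplitStrata        -- ★ (F0P3a-p01 (g36)): `v_le_pow_iff_of_eq`, `v_mul_self_le_pow_iff_of_eq`; brings ★ p859094 token reads, ★ p856661 T-strata orbit counts
import Summits.HodgeConjecture.HodgeConjecture.Theorems.F0P3cDyRamLabelledOddStageAOfRecord       -- ★ p860462 (this seat): brings ★ `finite_unitTorus_orbit_of_mem_normalisedStableLattices`, ★ `v_vecCons_eq_one_of_isElementDatum`
import Summits.HodgeConjecture.HodgeConjecture.Theorems.F0P3cDyRamStableCountTypeZero              -- ★ (LH4-p12): `finite_normalisedStableLattices`, `v_diag_eq_one`, `diag_regular`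
import Summits.HodgeConjecture.HodgeConjecture.Theorems.F0P3cDyRamStageOneBDefs                   -- ★ DEFS №5: `mcOfRecord`; brings `mstarOfRecord`
import HarnessLib

/-!
# Crux `H413`, line LH4 «(D-RAM) FOUR-FRAME» — (β-BAL) Stage B, THE PURE STRATA, FILE 1: the ON-BRANCH strata `T₂ = (s,0,s)` and `T₁ = (0,s,s)`
# `Σᶠ_{M ∈ stratum(a), clean shell} labelledOddCount σ ϖ 0 i Λ M ∕ [𝒰 : N(S̃′(M))] = [s + ℓ₀ = n_k ∧ 2 ∣ s] · c_i(a)∕2 · q^{s∕2}`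

Cell `hodgecm-mathlib` (D-0151), FLOOR 0, crux item H413 = `stmt-HodgeConjecture-24833`, route `HCCMUnconditional`; squad F0∕P3c∕LH4.  THEOREMS ONLY (no `def`, no instance, no
notation, no `sorry`, default heartbeats); ★-only imports; lane `--supports stmt-HodgeConjecture-24833 --as helper` (count-neutral); pays NO row, states NO law.

THE MATHEMATICS (SIG-PureCells v1 §0–§1; consumer LH4-p05 (g8)'s box assembler `table_of_box`).  FILE 1a gives the per-lattice value `(ω(e_A), 0, ω(−1)ω(e_A)·[d ≤ j])_i ∕ 2 ·
stabiliserWeight` on `M₂(2j,y)` (token `e_A` of `α − 1`) and its twin on `M₁(2j,z)` (token `e_B` of `β − 1`).  On the stratum `(s,0,s)` the three clean-shell tokens of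
`X = diag(α−1, β−1, 0)` read the constant `s + ℓ₀ = n₂` (★ p859094 token reads at the element letters), every member is `M₂(s,y)` with `s` even (★ B4), the orbit is finite (★),
`d ≤ s∕2` and `|β−1| ≤ |ϖ|^{m*}` follow from `mcOfRecord d ≤ N₀`, `2 ≤ d`, and ★ p856661 counts the orbits: `q^{s∕2}`.  So the stratum value is `[s+ℓ₀ = n₂ ∧ 2 ∣ s]·(ω(e_A), 0,
ω(−1)ω(e_A))_i∕2·q^{s∕2}` (§2); `(0,s,s)` likewise with `n₁`, `e_B`, slots `0 ↔ 1`.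
HONEST LABEL.  Count-neutral helper; two of the per-stratum values of LH4-p05 (g8)'s box; the table identity (SIG-B2b3), (β-BAL), (β), T₊ remain OPEN; `HC_CM` is proved only modulo
the 7 printed citations (2 remaining named inputs: hLiu418 = `stmt-HodgeConjecture-24832`, h413 = `stmt-HodgeConjecture-24833`) until rung 0 closes.

## References
* [Kottwitz1986BaseChangeUnits] R. E. Kottwitz, *Base change for unit elements of Hecke algebras*, Compositio Math. 60 (1986), §1 pp. 240–241.
* [Rogawski1990] J. D. Rogawski, *Automorphic Representations of Unitary Groups in Three Variables*, Ann. of Math. Stud. 123 (1990), §4.9 Prop. 4.9.1 (a)(b) p. 55, §4.10 p. 58.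
* [LanglandsShelstad1987] R. P. Langlands, D. Shelstad, *On the definition of transfer factors*, Math. Ann. 278 (1987), §3.
* [Serre1979] J.-P. Serre, *Local Fields*, GTM 67 (1979), Ch. V §3 Prop. 5, Cor. 3.
-/

set_option autoImplicit false

noncomputable section

namespace Summit.HodgeConjecture.HodgeConjecture.Cruxes.H413.F0P3cDyRamLabelledOddPureStrataT

open Literature.NumberTheory.Automorphic Literature.NumberTheory.Automorphic.HermitianLattice
open Literature.NumberTheory.Automorphic.UnitaryLatticeTree Literature.NumberTheory.Automorphic.UnitaryThreeFourFrame
open Literature.NumberTheory.LocalFields Literature.NumberTheory.LocalFields.WildQuadraticDatum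
open Summit.HodgeConjecture.HodgeConjecture.Cruxes.H413.F0P3cDyRamFourFramePieces
open Summit.HodgeConjecture.HodgeConjecture.Cruxes.H413.F0P3cDyRamFourFrameCensusDefs
open Summit.HodgeConjecture.HodgeConjecture.Cruxes.H413.F0P3cDyRamStageOneBDefs (mcOfRecord)
open Summit.HodgeConjecture.HodgeConjecture.Cruxes.H413.F0P3cDyRamDiagonalTorusDefs
open Summit.HodgeConjecture.HodgeConjecture.Cruxes.H413.F0P3cDyRamDiagonalStrataDefs
open Summit.HodgeConjecture.HodgeConjecture.Cruxes.H413.F0P3cDyRamLabelledOddCountDefs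
open Summit.HodgeConjecture.HodgeConjecture.Cruxes.H413.F0P3cDyRamDiagonalSplitCountAxisOne
open Summit.HodgeConjecture.HodgeConjecture.Cruxes.H413.F0P3cDyRamDiagonalSplitCountAxisTwo
open Summit.HodgeConjecture.HodgeConjecture.Cruxes.H413.F0P3cDyRamDiagonalSplitCountSockets
open Summit.HodgeConjecture.HodgeConjecture.Cruxes.H413.F0P3cDyRamLabelledSplitStrata
open Summit.HodgeConjecture.HodgeConjecture.Cruxes.H413.F0P3cDyRamLabelledKappaSplitStrata (v_le_pow_iff_of_eq v_mul_self_le_pow_iff_of_eq)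
open Summit.HodgeConjecture.HodgeConjecture.Cruxes.H413.F0P3cDyRamStableCountTypeZero (finite_normalisedStableLattices v_diag_eq_one diag_regular)
open Summit.HodgeConjecture.HodgeConjecture.Cruxes.H413.F0P3cDyRamDiagonalOrbitFibreCountHeads (finite_unitTorus_orbit_of_mem_normalisedStableLattices)
open Summit.HodgeConjecture.HodgeConjecture.Cruxes.H413.F0P3cDyRamLabelledOddPureLatticeT
open scoped Valued WithZero Matrix MatrixGroups

variable {K : Type} [Field K] [Valued K ℤᵐ⁰]

/-! ## §2  Per stratum, in LH4-p05 (g8)'s box currency: `T₂ = (s,0,s)` and `T₁ = (0,s,s)` cut by the clean shell of `X = diag(α−1, β−1, 0)` -/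

section Strata

variable [CompleteSpace K] [Fintype 𝓀[K]] {σ : K →+* K} {ϖ : K} {d t : ℕ} {α β : K} {N₀ n₁ n₂ n₃ : ℕ}

/-- **THE `T₂ = (s,0,s)` STRATUM ON THE CLEAN SHELL** (`s ≥ 1`; `2 ≤ d`, `mcOfRecord d ≤ N₀`; `e_A` the tower-sign token of `α − 1`):
`Σᶠ_{M ∈ stratum (s,0,s), shell} labelledOddCount σ ϖ 0 i Λ M ∕ [𝒰 : N(S̃′(M))] = [s + ℓ₀ = n₂ ∧ 2 ∣ s] · (ω(e_A), 0, ω(−1)ω(e_A))_i ∕ 2 · q^{s∕2}`,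
`Λ = valueClassLabel σ ϖ (α−1) (β−1) m* d` (the three shell tokens read `s + ℓ₀ = n₂` on the stratum by ★ p859094; §1 per lattice; ★ p856661's orbit count `q^{s∕2}`).
[cite: Kottwitz1986BaseChangeUnits, §1 pp. 240–241] [cite: Rogawski1990, §4.9 Prop. 4.9.1 (a)(b) p. 55, §4.10 p. 58] [cite: Serre1979, Ch. V §3 Prop. 5, Cor. 3] -/
theorem finsum_stratum_T2_shell_labelledOdd_div_relIndex_eq (hD : IsRamifiedQuadraticDatum σ ϖ d t) (h2d : 2 ≤ d)
    (hE : IsElementDatum σ ϖ N₀ α β n₁ n₂ n₃) (hmc : mcOfRecord d ≤ N₀)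
    (T : GL (Fin 3) K) (hT : (T : Matrix (Fin 3) (Fin 3) K) = Matrix.diagonal ![α, β, 1]) (s : ℕ) (hs : 1 ≤ s)
    {eA : K} (hσeA : σ eA = eA) (heA1 : Valued.v eA = 1)
    (heA : Valued.v ((ϖ ^ mstarOfRecord d)⁻¹ * ((α - 1) * ((ϖ * σ ϖ) ^ ((n₂ - d % 2) / 2))⁻¹ - eA * ((ϖ - σ ϖ) * ((ϖ * σ ϖ) ^ ((d - d % 2) / 2))⁻¹))) ≤ 1)
    (i : Fin 3) :
    ∑ᶠ M ∈ {M : Submodule 𝒪[K] (Fin 3 → K) | M ∈ stratum σ ϖ T ![s, 0, s] ∧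
        (LatticeInLevel ϖ (d % 2) (Matrix.diagonal ![α - 1, β - 1, 0]) M ∧ ¬ LatticeInLevel ϖ (d % 2 + 1) (Matrix.diagonal ![α - 1, β - 1, 0]) M ∧
          LatticeInLevel ϖ (mcOfRecord d) (Matrix.diagonal ![(α - 1) * (α - 1), (β - 1) * (β - 1), 0]) M)},
      (labelledOddCount σ ϖ 0 i (valueClassLabel σ ϖ (α - 1) (β - 1) (mstarOfRecord d) d) M : ℚ) /
        ((((unitStabilizer M).map (unitNormMap σ 3)).relIndex (fixedUnitTorus σ 3) : ℕ) : ℚ) =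
      if s + d % 2 = n₂ ∧ 2 ∣ s then
        ((if i = 0 then normSign σ eA else if i = 2 then normSign σ (-1 : K) * normSign σ eA else 0 : ℤ) : ℚ) / 2 * (Fintype.card 𝓀[K] : ℚ) ^ (s / 2)
      else 0 := by
  classical
  have hD' := hD
  obtain ⟨hσ, hvσ, hϖ, hfix, -, -, -⟩ := hD'
  have hϖ0 : ϖ ≠ 0 := fun h0 => by rw [h0, map_zero] at hϖ; exact WithZero.coe_ne_zero hϖ.symm
  have hϖ1 : Valued.v ϖ ≤ 1 := by rw [hϖ, ← WithZero.exp_zero, WithZero.exp_le_exp]; norm_num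
  have hα : Valued.v (α - 1) = Valued.v ϖ ^ n₂ := hE.2.2.2.2.2.2.1
  have hβ : Valued.v (β - 1) = Valued.v ϖ ^ n₁ := hE.2.2.2.2.2.1
  have hn₁ : N₀ ≤ n₁ := hE.2.2.2.2.2.2.2.2.1
  have hn₂ : N₀ ≤ n₂ := hE.2.2.2.2.2.2.2.2.2.1
  have hmcv : mcOfRecord d = 2 * ((d % 2 + 2 * d - 1 + d) / 2) := rfl
  have r1 := v_le_pow_iff_of_eq hD hα
  have r2 := v_le_pow_iff_of_eq hD hβ
  have r1' := v_mul_self_le_pow_iff_of_eq hD hα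
  have r2' := v_mul_self_le_pow_iff_of_eq hD hβ
  have hv0 : ∀ ℓ : ℕ, Valued.v (0 : K) ≤ Valued.v ϖ ^ ℓ := fun ℓ => by rw [map_zero]; exact zero_le
  -- the three tokens read `s + ℓ₀ = n₂` on the stratum
  have hread : ∀ M ∈ stratum σ ϖ T ![s, 0, s],
      (LatticeInLevel ϖ (d % 2) (Matrix.diagonal ![α - 1, β - 1, 0]) M ∧ ¬ LatticeInLevel ϖ (d % 2 + 1) (Matrix.diagonal ![α - 1, β - 1, 0]) M ∧
          LatticeInLevel ϖ (mcOfRecord d) (Matrix.diagonal ![(α - 1) * (α - 1), (β - 1) * (β - 1), 0]) M) ↔ s + d % 2 = n₂ := by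
    intro M hM
    obtain ⟨y, hy, rfl⟩ := (hasAxis_axis2_iff hϖ hM.1 hs).1 hM.2.2
    rw [latticeInLevel_diagonal_latt_T2_iff hϖ0 (d % 2) s _ hy, latticeInLevel_diagonal_latt_T2_iff hϖ0 (d % 2 + 1) s _ hy,
      latticeInLevel_diagonal_latt_T2_iff hϖ0 (mcOfRecord d) s _ hy]
    simp only [Matrix.cons_val_zero, Matrix.cons_val_one, Matrix.cons_val_two, Matrix.tail_cons, Matrix.head_cons, zero_sub, Valuation.map_neg,
      hv0, and_true, r1, r2, r1', r2']
    rw [hmcv] at hmc ⊢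
    constructor
    · rintro ⟨⟨-, h1⟩, h2, -⟩; omega
    · intro h; refine ⟨⟨⟨by omega, by omega⟩, by omega⟩, fun h' => by omega, ⟨by omega, by omega⟩, by omega⟩
  rw [finsum_mem_sep_eq_ite_of_forall_iff (stratum σ ϖ T ![s, 0, s]) _ _ hread]
  by_cases hP : s + d % 2 = n₂
  · rw [if_pos hP]
    by_cases h2s : 2 ∣ s
    · obtain ⟨j, hj⟩ := h2s
      rw [if_pos (show s + d % 2 = n₂ ∧ 2 ∣ s from ⟨hP, Dvd.intro j hj.symm⟩)]
      have hsv := v_diag_eq_one hvσ hE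
      have hreg := diag_regular hE
      have hx₁ : Valued.v (β - 1) ≤ Valued.v (ϖ ^ (d % 2 + 2 * d - 1)) := by
        rw [hβ, map_pow]; exact pow_le_pow_right_of_le_one' hϖ1 (by omega)
      have hjn : (n₂ - d % 2) / 2 = j := by omega
      rw [hjn] at heA
      have hdj : d ≤ j := by omega
      have hval : ∀ M ∈ stratum σ ϖ T ![s, 0, s],
          (labelledOddCount σ ϖ 0 i (valueClassLabel σ ϖ (α - 1) (β - 1) (mstarOfRecord d) d) M : ℚ) /
              ((((unitStabilizer M).map (unitNormMap σ 3)).relIndex (fixedUnitTorus σ 3) : ℕ) : ℚ) =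
            ((if i = 0 then normSign σ eA else if i = 2 then normSign σ (-1 : K) * normSign σ eA else 0 : ℤ) : ℚ) / 2 * stabiliserWeight σ M := by
        intro M hM
        obtain ⟨y, hy, hMe⟩ := (hasAxis_axis2_iff hϖ hM.1 hs).1 hM.2.2
        rw [hj] at hMe
        have h := labelledOddCount_div_relIndex_latt_axis2 hD hy j (α - 1) (β - 1) hx₁ hσeA heA1 heA hMe
          (finite_unitTorus_orbit_of_mem_normalisedStableLattices hϖ hsv hreg T hT hM.1) i
        rw [show mstarOfRecord d = d % 2 + 2 * d - 1 from rfl, h]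
        simp only [hdj, and_true]
      rw [finsum_mem_congr rfl hval, ← mul_finsum_mem, finsum_stabiliserWeight_hasAxis_T2 hD hE hT s hs, if_pos (show 2 ∣ s ∧ s ≤ n₂ from ⟨Dvd.intro j hj.symm, by omega⟩)]
    · rw [if_neg (fun h => h2s h.2)]
      have hzero : ∀ M ∈ stratum σ ϖ T ![s, 0, s],
          (labelledOddCount σ ϖ 0 i (valueClassLabel σ ϖ (α - 1) (β - 1) (mstarOfRecord d) d) M : ℚ) /
              ((((unitStabilizer M).map (unitNormMap σ 3)).relIndex (fixedUnitTorus σ 3) : ℕ) : ℚ) = 0 := by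
        intro M hM
        obtain ⟨y, hy, hMe⟩ := (hasAxis_axis2_iff hϖ hM.1 hs).1 hM.2.2
        exact absurd (two_dvd_of_isDualisableLattice_latt_axis2 hvσ hfix hϖ hy (hMe ▸ hM.2.1)) h2s
      rw [finsum_mem_congr rfl hzero]
      simp
  · rw [if_neg hP, if_neg (fun h => hP h.1)]

/-- **THE `T₁ = (0,s,s)` STRATUM ON THE CLEAN SHELL** (`s ≥ 1`; `2 ≤ d`, `mcOfRecord d ≤ N₀`; `e_B` the tower-sign token of `β − 1`):
`Σᶠ_{M ∈ stratum (0,s,s), shell} labelledOddCount σ ϖ 0 i Λ M ∕ [𝒰 : N(S̃′(M))] = [s + ℓ₀ = n₁ ∧ 2 ∣ s] · (0, ω(e_B), ω(−1)ω(e_B))_i ∕ 2 · q^{s∕2}`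
(the three shell tokens read `s + ℓ₀ = n₁` on the stratum by ★ p859094; §1 per lattice; ★ p856661's orbit count `q^{s∕2}`).
[cite: Kottwitz1986BaseChangeUnits, §1 pp. 240–241] [cite: Rogawski1990, §4.9 Prop. 4.9.1 (a)(b) p. 55, §4.10 p. 58] [cite: Serre1979, Ch. V §3 Prop. 5, Cor. 3] -/
theorem finsum_stratum_T1_shell_labelledOdd_div_relIndex_eq (hD : IsRamifiedQuadraticDatum σ ϖ d t) (h2d : 2 ≤ d)
    (hE : IsElementDatum σ ϖ N₀ α β n₁ n₂ n₃) (hmc : mcOfRecord d ≤ N₀)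
    (T : GL (Fin 3) K) (hT : (T : Matrix (Fin 3) (Fin 3) K) = Matrix.diagonal ![α, β, 1]) (s : ℕ) (hs : 1 ≤ s)
    {eB : K} (hσeB : σ eB = eB) (heB1 : Valued.v eB = 1)
    (heB : Valued.v ((ϖ ^ mstarOfRecord d)⁻¹ * ((β - 1) * ((ϖ * σ ϖ) ^ ((n₁ - d % 2) / 2))⁻¹ - eB * ((ϖ - σ ϖ) * ((ϖ * σ ϖ) ^ ((d - d % 2) / 2))⁻¹))) ≤ 1)
    (i : Fin 3) :
    ∑ᶠ M ∈ {M : Submodule 𝒪[K] (Fin 3 → K) | M ∈ stratum σ ϖ T ![0, s, s] ∧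
        (LatticeInLevel ϖ (d % 2) (Matrix.diagonal ![α - 1, β - 1, 0]) M ∧ ¬ LatticeInLevel ϖ (d % 2 + 1) (Matrix.diagonal ![α - 1, β - 1, 0]) M ∧
          LatticeInLevel ϖ (mcOfRecord d) (Matrix.diagonal ![(α - 1) * (α - 1), (β - 1) * (β - 1), 0]) M)},
      (labelledOddCount σ ϖ 0 i (valueClassLabel σ ϖ (α - 1) (β - 1) (mstarOfRecord d) d) M : ℚ) /
        ((((unitStabilizer M).map (unitNormMap σ 3)).relIndex (fixedUnitTorus σ 3) : ℕ) : ℚ) =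
      if s + d % 2 = n₁ ∧ 2 ∣ s then
        ((if i = 1 then normSign σ eB else if i = 2 then normSign σ (-1 : K) * normSign σ eB else 0 : ℤ) : ℚ) / 2 * (Fintype.card 𝓀[K] : ℚ) ^ (s / 2)
      else 0 := by
  classical
  have hD' := hD
  obtain ⟨hσ, hvσ, hϖ, hfix, -, -, -⟩ := hD'
  have hϖ0 : ϖ ≠ 0 := fun h0 => by rw [h0, map_zero] at hϖ; exact WithZero.coe_ne_zero hϖ.symm
  have hϖ1 : Valued.v ϖ ≤ 1 := by rw [hϖ, ← WithZero.exp_zero, WithZero.exp_le_exp]; norm_num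
  have hα : Valued.v (α - 1) = Valued.v ϖ ^ n₂ := hE.2.2.2.2.2.2.1
  have hβ : Valued.v (β - 1) = Valued.v ϖ ^ n₁ := hE.2.2.2.2.2.1
  have hn₁ : N₀ ≤ n₁ := hE.2.2.2.2.2.2.2.2.1
  have hn₂ : N₀ ≤ n₂ := hE.2.2.2.2.2.2.2.2.2.1
  have hmcv : mcOfRecord d = 2 * ((d % 2 + 2 * d - 1 + d) / 2) := rfl
  have r1 := v_le_pow_iff_of_eq hD hα
  have r2 := v_le_pow_iff_of_eq hD hβ
  have r1' := v_mul_self_le_pow_iff_of_eq hD hα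
  have r2' := v_mul_self_le_pow_iff_of_eq hD hβ
  have hv0 : ∀ ℓ : ℕ, Valued.v (0 : K) ≤ Valued.v ϖ ^ ℓ := fun ℓ => by rw [map_zero]; exact zero_le
  -- the three tokens read `s + ℓ₀ = n₁` on the stratum
  have hread : ∀ M ∈ stratum σ ϖ T ![0, s, s],
      (LatticeInLevel ϖ (d % 2) (Matrix.diagonal ![α - 1, β - 1, 0]) M ∧ ¬ LatticeInLevel ϖ (d % 2 + 1) (Matrix.diagonal ![α - 1, β - 1, 0]) M ∧
          LatticeInLevel ϖ (mcOfRecord d) (Matrix.diagonal ![(α - 1) * (α - 1), (β - 1) * (β - 1), 0]) M) ↔ s + d % 2 = n₁ := by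
    intro M hM
    obtain ⟨z, hz, rfl⟩ := (hasAxis_axis1_iff hϖ hM.1 hs).1 hM.2.2
    rw [latticeInLevel_diagonal_latt_T1_iff hϖ0 (d % 2) s _ hz, latticeInLevel_diagonal_latt_T1_iff hϖ0 (d % 2 + 1) s _ hz,
      latticeInLevel_diagonal_latt_T1_iff hϖ0 (mcOfRecord d) s _ hz]
    simp only [Matrix.cons_val_zero, Matrix.cons_val_one, Matrix.cons_val_two, Matrix.tail_cons, Matrix.head_cons, zero_sub, Valuation.map_neg,
      hv0, and_true, r1, r2, r1', r2']
    rw [hmcv] at hmc ⊢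
    constructor
    · rintro ⟨⟨-, h1⟩, h2, -⟩; omega
    · intro h; refine ⟨⟨⟨by omega, by omega⟩, by omega⟩, fun h' => by omega, ⟨by omega, by omega⟩, by omega⟩
  rw [finsum_mem_sep_eq_ite_of_forall_iff (stratum σ ϖ T ![0, s, s]) _ _ hread]
  by_cases hP : s + d % 2 = n₁
  · rw [if_pos hP]
    by_cases h2s : 2 ∣ s
    · obtain ⟨j, hj⟩ := h2s
      rw [if_pos (show s + d % 2 = n₁ ∧ 2 ∣ s from ⟨hP, Dvd.intro j hj.symm⟩)]
      have hsv := v_diag_eq_one hvσ hE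
      have hreg := diag_regular hE
      have hx₀ : Valued.v (α - 1) ≤ Valued.v (ϖ ^ (d % 2 + 2 * d - 1)) := by
        rw [hα, map_pow]; exact pow_le_pow_right_of_le_one' hϖ1 (by omega)
      have hjn : (n₁ - d % 2) / 2 = j := by omega
      rw [hjn] at heB
      have hdj : d ≤ j := by omega
      have hval : ∀ M ∈ stratum σ ϖ T ![0, s, s],
          (labelledOddCount σ ϖ 0 i (valueClassLabel σ ϖ (α - 1) (β - 1) (mstarOfRecord d) d) M : ℚ) /
              ((((unitStabilizer M).map (unitNormMap σ 3)).relIndex (fixedUnitTorus σ 3) : ℕ) : ℚ) =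
            ((if i = 1 then normSign σ eB else if i = 2 then normSign σ (-1 : K) * normSign σ eB else 0 : ℤ) : ℚ) / 2 * stabiliserWeight σ M := by
        intro M hM
        obtain ⟨z, hz, hMe⟩ := (hasAxis_axis1_iff hϖ hM.1 hs).1 hM.2.2
        rw [hj] at hMe
        have h := labelledOddCount_div_relIndex_latt_axis1 hD hz j (α - 1) (β - 1) hx₀ hσeB heB1 heB hMe
          (finite_unitTorus_orbit_of_mem_normalisedStableLattices hϖ hsv hreg T hT hM.1) i
        rw [show mstarOfRecord d = d % 2 + 2 * d - 1 from rfl, h]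
        simp only [hdj, and_true]
      rw [finsum_mem_congr rfl hval, ← mul_finsum_mem, finsum_stabiliserWeight_hasAxis_T1 hD hE hT s hs, if_pos (show 2 ∣ s ∧ s ≤ n₁ from ⟨Dvd.intro j hj.symm, by omega⟩)]
    · rw [if_neg (fun h => h2s h.2)]
      have hzero : ∀ M ∈ stratum σ ϖ T ![0, s, s],
          (labelledOddCount σ ϖ 0 i (valueClassLabel σ ϖ (α - 1) (β - 1) (mstarOfRecord d) d) M : ℚ) /
              ((((unitStabilizer M).map (unitNormMap σ 3)).relIndex (fixedUnitTorus σ 3) : ℕ) : ℚ) = 0 := by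
        intro M hM
        obtain ⟨z, hz, hMe⟩ := (hasAxis_axis1_iff hϖ hM.1 hs).1 hM.2.2
        exact absurd (two_dvd_of_isDualisableLattice_latt_axis1 hvσ hfix hϖ hz (hMe ▸ hM.2.1)) h2s
      rw [finsum_mem_congr rfl hzero]
      simp
  · rw [if_neg hP, if_neg (fun h => hP h.1)]

end Strata

/-! ## §3 (ED. 2, append-only) Token-free vanishing off the read (LH4-p05 (g8) 13:50:25Z ∕ 13:55:08Z parity ask: at a wrong-parity depth no tower-sign
token exists, yet the box still holds the stratum — its summand is `0` without any token) -/

section Zero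

variable {σ : K →+* K} {ϖ : K} {d t : ℕ} {α β : K} {N₀ n₁ n₂ n₃ : ℕ}

/-- **`T₂ = (s,0,s)` OFF THE READ, TOKEN-FREE**: if `¬ (s + ℓ₀ = n₂ ∧ 2 ∣ s)` the clean-shell cut of the stratum `(s,0,s)` carries labelled odd value `0` in every slot (the three tokens
read `s + ℓ₀ = n₂` on the stratum, ★ p859094; an odd `s` leaves the stratum empty, ★ B4). [cite: Kottwitz1986BaseChangeUnits, §1 pp. 240–241] [cite: Rogawski1990, §4.9 Prop. 4.9.1 (a) p. 55] -/
theorem finsum_stratum_T2_shell_labelledOdd_div_relIndex_eq_zero_of_not (hD : IsRamifiedQuadraticDatum σ ϖ d t) (h2d : 2 ≤ d)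
    (hE : IsElementDatum σ ϖ N₀ α β n₁ n₂ n₃) (hmc : mcOfRecord d ≤ N₀)
    (T : GL (Fin 3) K) (s : ℕ) (hs : 1 ≤ s) (hnot : ¬ (s + d % 2 = n₂ ∧ 2 ∣ s)) (i : Fin 3) :
    ∑ᶠ M ∈ {M : Submodule 𝒪[K] (Fin 3 → K) | M ∈ stratum σ ϖ T ![s, 0, s] ∧
        (LatticeInLevel ϖ (d % 2) (Matrix.diagonal ![α - 1, β - 1, 0]) M ∧ ¬ LatticeInLevel ϖ (d % 2 + 1) (Matrix.diagonal ![α - 1, β - 1, 0]) M ∧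
          LatticeInLevel ϖ (mcOfRecord d) (Matrix.diagonal ![(α - 1) * (α - 1), (β - 1) * (β - 1), 0]) M)},
      (labelledOddCount σ ϖ 0 i (valueClassLabel σ ϖ (α - 1) (β - 1) (mstarOfRecord d) d) M : ℚ) /
        ((((unitStabilizer M).map (unitNormMap σ 3)).relIndex (fixedUnitTorus σ 3) : ℕ) : ℚ) = 0 := by
  classical
  have hD' := hD
  obtain ⟨hσ, hvσ, hϖ, hfix, -, -, -⟩ := hD'
  have hϖ0 : ϖ ≠ 0 := fun h0 => by rw [h0, map_zero] at hϖ; exact WithZero.coe_ne_zero hϖ.symm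
  have hα : Valued.v (α - 1) = Valued.v ϖ ^ n₂ := hE.2.2.2.2.2.2.1
  have hβ : Valued.v (β - 1) = Valued.v ϖ ^ n₁ := hE.2.2.2.2.2.1
  have hn₁ : N₀ ≤ n₁ := hE.2.2.2.2.2.2.2.2.1
  have hn₂ : N₀ ≤ n₂ := hE.2.2.2.2.2.2.2.2.2.1
  have hmcv : mcOfRecord d = 2 * ((d % 2 + 2 * d - 1 + d) / 2) := rfl
  have r1 := v_le_pow_iff_of_eq hD hα
  have r2 := v_le_pow_iff_of_eq hD hβ
  have r1' := v_mul_self_le_pow_iff_of_eq hD hα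
  have r2' := v_mul_self_le_pow_iff_of_eq hD hβ
  have hv0 : ∀ ℓ : ℕ, Valued.v (0 : K) ≤ Valued.v ϖ ^ ℓ := fun ℓ => by rw [map_zero]; exact zero_le
  have hread : ∀ M ∈ stratum σ ϖ T ![s, 0, s],
      (LatticeInLevel ϖ (d % 2) (Matrix.diagonal ![α - 1, β - 1, 0]) M ∧ ¬ LatticeInLevel ϖ (d % 2 + 1) (Matrix.diagonal ![α - 1, β - 1, 0]) M ∧
          LatticeInLevel ϖ (mcOfRecord d) (Matrix.diagonal ![(α - 1) * (α - 1), (β - 1) * (β - 1), 0]) M) ↔ s + d % 2 = n₂ := by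
    intro M hM
    obtain ⟨y, hy, rfl⟩ := (hasAxis_axis2_iff hϖ hM.1 hs).1 hM.2.2
    rw [latticeInLevel_diagonal_latt_T2_iff hϖ0 (d % 2) s _ hy, latticeInLevel_diagonal_latt_T2_iff hϖ0 (d % 2 + 1) s _ hy,
      latticeInLevel_diagonal_latt_T2_iff hϖ0 (mcOfRecord d) s _ hy]
    simp only [Matrix.cons_val_zero, Matrix.cons_val_one, Matrix.cons_val_two, Matrix.tail_cons, Matrix.head_cons, zero_sub, Valuation.map_neg,
      hv0, and_true, r1, r2, r1', r2']
    rw [hmcv] at hmc ⊢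
    constructor
    · rintro ⟨⟨-, h1⟩, h2, -⟩; omega
    · intro h; refine ⟨⟨⟨by omega, by omega⟩, by omega⟩, fun h' => by omega, ⟨by omega, by omega⟩, by omega⟩
  rw [finsum_mem_sep_eq_ite_of_forall_iff (stratum σ ϖ T ![s, 0, s]) _ _ hread]
  by_cases hP : s + d % 2 = n₂
  · rw [if_pos hP]
    have h2s : ¬ 2 ∣ s := fun h => hnot ⟨hP, h⟩
    have hzero : ∀ M ∈ stratum σ ϖ T ![s, 0, s],
        (labelledOddCount σ ϖ 0 i (valueClassLabel σ ϖ (α - 1) (β - 1) (mstarOfRecord d) d) M : ℚ) /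
            ((((unitStabilizer M).map (unitNormMap σ 3)).relIndex (fixedUnitTorus σ 3) : ℕ) : ℚ) = 0 := by
      intro M hM
      obtain ⟨y, hy, hMe⟩ := (hasAxis_axis2_iff hϖ hM.1 hs).1 hM.2.2
      exact absurd (two_dvd_of_isDualisableLattice_latt_axis2 hvσ hfix hϖ hy (hMe ▸ hM.2.1)) h2s
    rw [finsum_mem_congr rfl hzero]
    simp
  · rw [if_neg hP]

/-- **`T₁ = (0,s,s)` OFF THE READ, TOKEN-FREE**: if `¬ (s + ℓ₀ = n₁ ∧ 2 ∣ s)` the clean-shell cut of the stratum `(0,s,s)` carries labelled odd value `0` in every slot.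
[cite: Kottwitz1986BaseChangeUnits, §1 pp. 240–241] [cite: Rogawski1990, §4.9 Prop. 4.9.1 (a) p. 55] -/
theorem finsum_stratum_T1_shell_labelledOdd_div_relIndex_eq_zero_of_not (hD : IsRamifiedQuadraticDatum σ ϖ d t) (h2d : 2 ≤ d)
    (hE : IsElementDatum σ ϖ N₀ α β n₁ n₂ n₃) (hmc : mcOfRecord d ≤ N₀)
    (T : GL (Fin 3) K) (s : ℕ) (hs : 1 ≤ s) (hnot : ¬ (s + d % 2 = n₁ ∧ 2 ∣ s)) (i : Fin 3) :
    ∑ᶠ M ∈ {M : Submodule 𝒪[K] (Fin 3 → K) | M ∈ stratum σ ϖ T ![0, s, s] ∧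
        (LatticeInLevel ϖ (d % 2) (Matrix.diagonal ![α - 1, β - 1, 0]) M ∧ ¬ LatticeInLevel ϖ (d % 2 + 1) (Matrix.diagonal ![α - 1, β - 1, 0]) M ∧
          LatticeInLevel ϖ (mcOfRecord d) (Matrix.diagonal ![(α - 1) * (α - 1), (β - 1) * (β - 1), 0]) M)},
      (labelledOddCount σ ϖ 0 i (valueClassLabel σ ϖ (α - 1) (β - 1) (mstarOfRecord d) d) M : ℚ) /
        ((((unitStabilizer M).map (unitNormMap σ 3)).relIndex (fixedUnitTorus σ 3) : ℕ) : ℚ) = 0 := by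
  classical
  have hD' := hD
  obtain ⟨hσ, hvσ, hϖ, hfix, -, -, -⟩ := hD'
  have hϖ0 : ϖ ≠ 0 := fun h0 => by rw [h0, map_zero] at hϖ; exact WithZero.coe_ne_zero hϖ.symm
  have hα : Valued.v (α - 1) = Valued.v ϖ ^ n₂ := hE.2.2.2.2.2.2.1
  have hβ : Valued.v (β - 1) = Valued.v ϖ ^ n₁ := hE.2.2.2.2.2.1
  have hn₁ : N₀ ≤ n₁ := hE.2.2.2.2.2.2.2.2.1
  have hn₂ : N₀ ≤ n₂ := hE.2.2.2.2.2.2.2.2.2.1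
  have hmcv : mcOfRecord d = 2 * ((d % 2 + 2 * d - 1 + d) / 2) := rfl
  have r1 := v_le_pow_iff_of_eq hD hα
  have r2 := v_le_pow_iff_of_eq hD hβ
  have r1' := v_mul_self_le_pow_iff_of_eq hD hα
  have r2' := v_mul_self_le_pow_iff_of_eq hD hβ
  have hv0 : ∀ ℓ : ℕ, Valued.v (0 : K) ≤ Valued.v ϖ ^ ℓ := fun ℓ => by rw [map_zero]; exact zero_le
  have hread : ∀ M ∈ stratum σ ϖ T ![0, s, s],
      (LatticeInLevel ϖ (d % 2) (Matrix.diagonal ![α - 1, β - 1, 0]) M ∧ ¬ LatticeInLevel ϖ (d % 2 + 1) (Matrix.diagonal ![α - 1, β - 1, 0]) M ∧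
          LatticeInLevel ϖ (mcOfRecord d) (Matrix.diagonal ![(α - 1) * (α - 1), (β - 1) * (β - 1), 0]) M) ↔ s + d % 2 = n₁ := by
    intro M hM
    obtain ⟨z, hz, rfl⟩ := (hasAxis_axis1_iff hϖ hM.1 hs).1 hM.2.2
    rw [latticeInLevel_diagonal_latt_T1_iff hϖ0 (d % 2) s _ hz, latticeInLevel_diagonal_latt_T1_iff hϖ0 (d % 2 + 1) s _ hz,
      latticeInLevel_diagonal_latt_T1_iff hϖ0 (mcOfRecord d) s _ hz]
    simp only [Matrix.cons_val_zero, Matrix.cons_val_one, Matrix.cons_val_two, Matrix.tail_cons, Matrix.head_cons, zero_sub, Valuation.map_neg,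
      hv0, and_true, r1, r2, r1', r2']
    rw [hmcv] at hmc ⊢
    constructor
    · rintro ⟨⟨-, h1⟩, h2, -⟩; omega
    · intro h; refine ⟨⟨⟨by omega, by omega⟩, by omega⟩, fun h' => by omega, ⟨by omega, by omega⟩, by omega⟩
  rw [finsum_mem_sep_eq_ite_of_forall_iff (stratum σ ϖ T ![0, s, s]) _ _ hread]
  by_cases hP : s + d % 2 = n₁
  · rw [if_pos hP]
    have h2s : ¬ 2 ∣ s := fun h => hnot ⟨hP, h⟩
    have hzero : ∀ M ∈ stratum σ ϖ T ![0, s, s],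
        (labelledOddCount σ ϖ 0 i (valueClassLabel σ ϖ (α - 1) (β - 1) (mstarOfRecord d) d) M : ℚ) /
            ((((unitStabilizer M).map (unitNormMap σ 3)).relIndex (fixedUnitTorus σ 3) : ℕ) : ℚ) = 0 := by
      intro M hM
      obtain ⟨z, hz, hMe⟩ := (hasAxis_axis1_iff hϖ hM.1 hs).1 hM.2.2
      exact absurd (two_dvd_of_isDualisableLattice_latt_axis1 hvσ hfix hϖ hz (hMe ▸ hM.2.1)) h2s
    rw [finsum_mem_congr rfl hzero]
    simp
  · rw [if_neg hP]

end Zero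

end Summit.HodgeConjecture.HodgeConjecture.Cruxes.H413.F0P3cDyRamLabelledOddPureStrataT

end
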